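import Summits.ABC.ABC.Theorems.FeketeScalesSubmultOfRSTBridge

/-!
# Crux `ScaleSubmultiplicativity` (stmt-ABC-2160): the exponent the record model predicts

The landed support item `SubmultOfRST` (stmt-ABC-10340, `submultOfRST_proof`) derives the crux from the pointwise
sub-power slack `c < rad · exp(A (log rad)^τ)` (`τ < 1`) with the exponent `θ = (1 + τ⁺)/2`, and the bridge
`SubmultOfRST.scaleSubmultiplicativity_of_rstConjectureAUpper` instantiates `τ = 1/2` from Robert–Stewart–Tenenbaum's
Conjecture A (upper half), whence the `θ = 3/4` quoted in the route file.  The halving is an artefact: this file records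
the sharp statement.

* `ScaleSubmultiplicativity.at_exponent_of_subpowerSlack` — the sub-power slack with exponent `τ` gives the crux's
  inequality at EVERY exponent `θ > τ⁺ := max τ 0` (`K = 16`, threshold depending on `θ - τ⁺`):
  `A (log rad)^τ ≤ B (log R₁R₂)^{τ⁺} ≤ (log R₁R₂)^θ` once `(log R₁R₂)^{θ-τ⁺} ≥ B`, shadows `(1, 2ⁿ-1, 2ⁿ)`.
* `ScaleSubmultiplicativity.at_exponent_of_rstConjectureAUpper` — hence `RSTConjectureAUpper` gives the crux's
  inequality at every `θ > 1/2`: in the normal form of `ScaleSubmultiplicativity.iff_exponent_ge` (only `θ → 1⁻`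
  matters for the STATEMENT), the record model predicts the whole half-line `θ ∈ (1/2, 1)`, matching the census window
  (BarrierNotesIdeator3 §C: measured `K(R₀, θ)` decreasing in `R₀` for `θ ≥ 1/2`).

Kernel facts about the crux's logical position (`--supports stmt-ABC-2160`); the second is CONDITIONAL on the open
conjecture `Literature.Barriers.ABC.RSTConjectureAUpper`, taken as a hypothesis.
[cite: RobertStewartTenenbaum2014, Conjecture A (1.5), §1 p. 1157]
-/

-- `Summit.<Summit>.<Problem>` is the mandated summit-side namespace (CONVENTIONS §2); for the
-- single-conjunct summit `ABC` the two coincide, so the duplicate `ABC.ABC` is deliberate.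
set_option linter.dupNamespace false

namespace Summit.ABC.ABC.Theorems

open Literature.NumberTheory.DiophantineGeometry Literature.Barriers.ABC
open Summit.ABC.ABC.Theses.FeketeScales

/-- **The sub-power slack gives the crux at every exponent above `τ⁺`.**  If every abc triple satisfies
`c < rad · exp(A (log rad)^τ)`, then for every `θ > max τ 0` there are `K > 0` (namely `16`) and `R₀` such that every
abc triple of radical `≤ R₁R₂` (`R₁, R₂ ≥ R₀`) is shadowed: `c ≤ K e^{(log R₁R₂)^θ} c₁ c₂` for abc triples of radical
`≤ R₁`, `≤ R₂` (the dyadic witnesses `(1, 2ⁿ-1, 2ⁿ)`, `cᵢ > Rᵢ/4`).  Sharpens `submultOfRST_proof` (`θ = (1+τ⁺)/2`).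
[folklore] -/
theorem ScaleSubmultiplicativity.at_exponent_of_subpowerSlack :
    ∀ τ A θ : ℝ, max τ 0 < θ →
    (∀ a b c : ℕ, IsABCTriple a b c →
      (c : ℝ) < ((rad a b c : ℕ) : ℝ) * Real.exp (A * Real.log ((rad a b c : ℕ) : ℝ) ^ τ)) →
    ∃ K : ℝ, 0 < K ∧ ∃ R₀ : ℕ, ∀ R₁ R₂ : ℕ, R₀ ≤ R₁ → R₀ ≤ R₂ → ∀ a b c : ℕ,
      IsABCTriple a b c → rad a b c ≤ R₁ * R₂ → ∃ a₁ b₁ c₁ a₂ b₂ c₂ : ℕ, IsABCTriple a₁ b₁ c₁ ∧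
        rad a₁ b₁ c₁ ≤ R₁ ∧ IsABCTriple a₂ b₂ c₂ ∧ rad a₂ b₂ c₂ ≤ R₂ ∧
        (c : ℝ) ≤ K * Real.exp (Real.log ((R₁ : ℝ) * R₂) ^ θ) * c₁ * c₂ := by
  intro τ A θ hτθ h
  set t : ℝ := max τ 0 with ht_def
  have ht0 : 0 ≤ t := le_max_right _ _
  set B : ℝ := |A| * max 1 (Real.log 2 ^ τ) with hB_def
  have hs : 0 < θ - t := by linarith
  obtain ⟨N₀, hN₀⟩ := SubmultOfRST.exists_threshold B hs
  refine ⟨16, by norm_num, max N₀ 4, fun R₁ R₂ hR₁ hR₂ a b c habc hrad => ?_⟩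
  have h4R₁ : 4 ≤ R₁ := (le_max_right _ _).trans hR₁
  have h4R₂ : 4 ≤ R₂ := (le_max_right _ _).trans hR₂
  obtain ⟨a₁, b₁, c₁, h₁, hr₁, hc₁⟩ := SubmultOfRST.exists_triple_at_scale h4R₁
  obtain ⟨a₂, b₂, c₂, h₂, hr₂, hc₂⟩ := SubmultOfRST.exists_triple_at_scale h4R₂
  refine ⟨a₁, b₁, c₁, a₂, b₂, c₂, h₁, hr₁, h₂, hr₂, ?_⟩
  -- real-number bookkeeping
  have hR₁c : (R₁ : ℝ) < 4 * c₁ := by exact_mod_cast hc₁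
  have hR₂c : (R₂ : ℝ) < 4 * c₂ := by exact_mod_cast hc₂
  have hR₁0 : (0 : ℝ) < R₁ := by exact_mod_cast (show 0 < R₁ by omega)
  have hR₂0 : (0 : ℝ) < R₂ := by exact_mod_cast (show 0 < R₂ by omega)
  have hcast : ((R₁ * R₂ : ℕ) : ℝ) = (R₁ : ℝ) * R₂ := by push_cast; ring
  have hradR : ((rad a b c : ℕ) : ℝ) ≤ (R₁ : ℝ) * R₂ := by rw [← hcast]; exact_mod_cast hrad
  have hrad0 : (0 : ℝ) ≤ ((rad a b c : ℕ) : ℝ) := Nat.cast_nonneg _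
  have hL1 : 1 ≤ Real.log ((R₁ : ℝ) * R₂) := by
    rw [Real.le_log_iff_exp_le (by positivity)]
    have he : Real.exp 1 < 3 := Real.exp_one_lt_three
    have h4 : (4 : ℝ) ≤ R₁ := by exact_mod_cast h4R₁
    have h4' : (4 : ℝ) ≤ R₂ := by exact_mod_cast h4R₂
    nlinarith
  have hL0 : 0 ≤ Real.log ((R₁ : ℝ) * R₂) := zero_le_one.trans hL1
  -- the slack: `A (log rad)^τ ≤ B L^t ≤ L^{θ-t} L^t = L^θ`
  have hslack : A * Real.log ((rad a b c : ℕ) : ℝ) ^ τ ≤ Real.log ((R₁ : ℝ) * R₂) ^ θ := by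
    have h1 : A * Real.log ((rad a b c : ℕ) : ℝ) ^ τ ≤ B * Real.log ((R₁ : ℝ) * R₂) ^ t := by
      have := SubmultOfRST.slack_le (τ := τ) (A := A) habc hrad
      rwa [hcast] at this
    have h2 : B ≤ Real.log ((R₁ : ℝ) * R₂) ^ (θ - t) := by
      have hN : N₀ ≤ R₁ * R₂ := ((le_max_left _ _).trans hR₁).trans (Nat.le_mul_of_pos_right _ (by omega))
      have := hN₀ (R₁ * R₂) hN
      rwa [hcast] at this
    calc A * Real.log ((rad a b c : ℕ) : ℝ) ^ τ ≤ B * Real.log ((R₁ : ℝ) * R₂) ^ t := h1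
      _ ≤ Real.log ((R₁ : ℝ) * R₂) ^ (θ - t) * Real.log ((R₁ : ℝ) * R₂) ^ t :=
          mul_le_mul_of_nonneg_right h2 (Real.rpow_nonneg hL0 t)
      _ = Real.log ((R₁ : ℝ) * R₂) ^ θ := by
          rw [← Real.rpow_add_of_nonneg hL0 hs.le ht0]; ring_nf
  -- assemble
  have hE : 0 < Real.exp (Real.log ((R₁ : ℝ) * R₂) ^ θ) := Real.exp_pos _
  have hprod : (R₁ : ℝ) * R₂ ≤ 16 * ((c₁ : ℝ) * c₂) := by nlinarith
  calc (c : ℝ) ≤ ((rad a b c : ℕ) : ℝ) * Real.exp (A * Real.log ((rad a b c : ℕ) : ℝ) ^ τ) := (h a b c habc).le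
    _ ≤ ((R₁ : ℝ) * R₂) * Real.exp (Real.log ((R₁ : ℝ) * R₂) ^ θ) :=
        mul_le_mul hradR (Real.exp_le_exp.mpr hslack) (Real.exp_pos _).le (by positivity)
    _ ≤ (16 * ((c₁ : ℝ) * c₂)) * Real.exp (Real.log ((R₁ : ℝ) * R₂) ^ θ) :=
        mul_le_mul_of_nonneg_right hprod hE.le
    _ = 16 * Real.exp (Real.log ((R₁ : ℝ) * R₂) ^ θ) * c₁ * c₂ := by ring

/-- **RST Conjecture A (upper half) gives the crux at every exponent `θ > 1/2`.**  By `rstExponent_le`,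
`c < k e^{rstExponent C₁ k} ≤ k exp(4√3 (3/2 + |C₁|) (log k)^{1/2})`, `k = rad(abc)`, i.e. the sub-power slack with
`τ = 1/2`; then `at_exponent_of_subpowerSlack`.  So in the normal form `ScaleSubmultiplicativity.iff_exponent_ge` the
record model predicts the crux on the whole window `θ ∈ (1/2, 1)`, not only at `3/4`.  CONDITIONAL on the open
conjecture `RSTConjectureAUpper`, taken as a hypothesis. [cite: RobertStewartTenenbaum2014, Conjecture A (1.5), §1 p. 1157] -/
theorem ScaleSubmultiplicativity.at_exponent_of_rstConjectureAUpper :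
    Literature.Barriers.ABC.RSTConjectureAUpper → ∀ θ : ℝ, 1 / 2 < θ →
    ∃ K : ℝ, 0 < K ∧ ∃ R₀ : ℕ, ∀ R₁ R₂ : ℕ, R₀ ≤ R₁ → R₀ ≤ R₂ → ∀ a b c : ℕ,
      IsABCTriple a b c → rad a b c ≤ R₁ * R₂ → ∃ a₁ b₁ c₁ a₂ b₂ c₂ : ℕ, IsABCTriple a₁ b₁ c₁ ∧
        rad a₁ b₁ c₁ ≤ R₁ ∧ IsABCTriple a₂ b₂ c₂ ∧ rad a₂ b₂ c₂ ≤ R₂ ∧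
        (c : ℝ) ≤ K * Real.exp (Real.log ((R₁ : ℝ) * R₂) ^ θ) * c₁ * c₂ := by
  rintro ⟨C₁, hC₁⟩ θ hθ
  have hslack : ∀ a b c : ℕ, IsABCTriple a b c → (c : ℝ) < ((rad a b c : ℕ) : ℝ) *
      Real.exp (4 * Real.sqrt 3 * (3 / 2 + |C₁|) * Real.log ((rad a b c : ℕ) : ℝ) ^ (1 / 2 : ℝ)) := by
    intro a b c habc
    have hk1 : (1 : ℝ) ≤ ((rad a b c : ℕ) : ℝ) := by
      exact_mod_cast Nat.succ_le_of_lt (Nat.radical_pos _)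
    have hle : rstExponent C₁ ((rad a b c : ℕ) : ℝ) ≤
        4 * Real.sqrt 3 * (3 / 2 + |C₁|) * Real.log ((rad a b c : ℕ) : ℝ) ^ (1 / 2 : ℝ) := by
      rw [← Real.sqrt_eq_rpow]
      exact rstExponent_le C₁ hk1
    calc (c : ℝ) < ((rad a b c : ℕ) : ℝ) * Real.exp (rstExponent C₁ ((rad a b c : ℕ) : ℝ)) :=
          hC₁ a b c habc
      _ ≤ ((rad a b c : ℕ) : ℝ) *
            Real.exp (4 * Real.sqrt 3 * (3 / 2 + |C₁|) * Real.log ((rad a b c : ℕ) : ℝ) ^ (1 / 2 : ℝ)) :=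
          mul_le_mul_of_nonneg_left (Real.exp_le_exp.mpr hle) (Nat.cast_nonneg _)
  have hmax : max (1 / 2 : ℝ) 0 < θ := by
    rw [max_eq_left (by norm_num : (0 : ℝ) ≤ 1 / 2)]; exact hθ
  exact ScaleSubmultiplicativity.at_exponent_of_subpowerSlack _ _ _ hmax hslack

end Summit.ABC.ABC.Theorems
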